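import Literature.Geometry.Lorentzian.CauchyDevelopment
import Literature.Geometry.Lorentzian.KerrAdaptedLayerNorm
import HarnessLib

/-!
# Admissible Kerr-adapted initial data layers inside a Cauchy development and the
# `𝓘⁺`-transversal cone distance to `Kerr(M, a)`

Definition request `defn-ConeSeedData` (decomposition cell of the summit `FinalStateConjecture`,
lens-5 NODE-g4 §5, wanted by `stmt-FinalStateConjecture-27603`), **variant D1′** of the request.
The requester's words: *"Variant D1′ (closer to the theorem used for Kerr): the Klainerman–Szeftel
INITIAL DATA LAYER `𝓛₀ ⊂ 𝒟.carrier` with the frame norms `ℑ_k` of arXiv:2104.11857 (§ initial data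
layer norm, pp. 43–51). Either [D1 or D1′] yields an `𝓘⁺`-transversal smallness functional
`coneDist 𝒟 (M, a) k : (leaf) → ℝ≥0∞` (no definitional monotonicity claimed). … no free data: a
predicate/structure on leaves of a given development … use existing Lorentzian vocabulary … keep it
sorry-free and instance-free."* The full variant D1 (DOUBLE-NULL characteristic seed data
`C_out ∪ C̲_in` with the Dafermos–Holzegel–Rodnianski–Taylor seed quantities and `𝔼_seed^k`,
arXiv:2104.08222, Ch. 8) is NOT typed here: it needs a dynamically normalised double-null gauge
(the request's own kill criterion "fall back to D1′"); this file is the layer variant, over notions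
the tree already has.

## What the source prints (Klainerman–Szeftel, arXiv:2104.11857 = PAMQ 19 (2023))

* §3.1 (arXiv p. 43) "Initial data layer": a spacetime REGION `(𝓛₀, g)`, `g` close to `Kerr(a₀, m₀)`,
  `𝓛₀ = 𝓛_ext ∪ 𝓛_int`, past boundary non-spacelike, "`𝓛_ext` is unbounded in the future outgoing
  directions"; §3.6 the initial layer norm `ℑ_k` (weighted sup norms of `≤ k` derivatives of the
  Ricci coefficients and curvature components relative to Kerr in the outgoing/ingoing PG frames).
* Def. 4.2 (arXiv p. 51): "an initial data layer `𝓛₀ = 𝓛₀(a₀, m₀)` … is ADMISSIBLE if it lies in the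
  future of an asymptotically flat initial data set, supported on a spacelike hypersurface `Σ₀` …;
  `𝓛₀` is `(ε₀, k)`-admissible if `ℑ_k ≤ ε₀²`"; Remark 4.3: Klainerman–Nicolò / Caciotta–Nicolò
  produce admissible layers from Cauchy data; Def. 4.4: a development of an admissible layer is a
  development of the data set supported on `Σ₀`; Main Theorem (p. 52): an `(ε₀, k_large + 10)`-
  admissible layer with `|a₀|/m₀ ≪ 1` has a future null complete development converging to a nearby
  Kerr.

## Rendering (namespace `Literature.Geometry.Lorentzian`)

The tree already renders KS's layer and `ℑ_k` in coordinates, for `N` receding holes, as the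
Kerr-ADAPTED layer `KerrAdapted.layer M a Λ ξ τ ℓ ⊆ E4` (leaves `{s = s₀}`, `0 < s₀ < ℓ`, asymptotic
to the outgoing null cones of the Kerr–Schild background INCLUDING the tortoise logarithm, so that
they reach a cut of `𝓘⁺` and not `i⁰`; near part `{|x̲| ≤ ℓ}`, far part `{|x̲| ≥ ℓ}`, cores
`{r ≤ M}` excised) and the norm `Spacetime.kerrAdaptedLayerNorm` of a chart `Φ : layer → 𝓢.carrier`
(near `Cᵏ` sup of the deviation `Φ^* g − g_{M,a}` + square roots of the far `r^p` and transversal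
fluxes), `KerrAdaptedLayerNorm.lean` (its module docstring records the comparison with `ℑ_k` and
with DHRT's cone energies). This file specialises to ONE hole at rest at the origin of its own
chart (`N = 1`, `Λ = 1`, `ξ = 0`; a chart INTO an abstract development carries no preferred frame,
so nothing is lost) and places the layer INSIDE a Cauchy development:

* `KerrAdapted.restLayer M a τ ℓ`, `KerrAdapted.restBackground M a τ ℓ` — the one-hole layer and
  its Kerr–Schild reference background (abbreviations of the `N`-hole objects; the same terms as the
  summit-side `twinLayer` / `twinBackground` of the `SettledCapture` lines, which may be restated
  over them).
* `Spacetime.kerrLayerNorm 𝓢 M a τ ℓ k p δ Φ` — the one-hole `kerrAdaptedLayerNorm` (`kerrLayerNorm_eq`).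
* `CauchyDevelopment.KerrLayerChart 𝒟 M a τ ℓ` — an **admissible Kerr-adapted initial data layer
  of `Kerr(M, a)` inside the development `𝒟`** (KS §3.1 + Def. 4.2, in chart form): a map
  `Φ : restLayer M a τ ℓ → 𝒟.carrier` which is smooth, an open embedding (so `Φ(𝓛)` is an open
  spacetime region of `𝒟` charted by the layer — "no free data": everything below is read off
  `𝒟.metric` through `Φ`), whose image lies in the causal future `J⁺(ι(X))` of the Cauchy
  hypersurface of `𝒟` (ADMISSIBILITY, Def. 4.2 verbatim: "lies in the future of an asymptotically
  flat initial data set" — here the data set of which `𝒟` is a development), and which is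
  time-oriented: `dΦ` maps the Kerr–Schild time vector `Kerr.timeVector M a` to future-directed
  vectors of `𝒟` (the four clauses, word for word, of the layer charts in the summit's
  `SettledCapture` lines).
* `KerrLayerChart.layerNorm c k p δ = 𝒟.kerrLayerNorm M a τ ℓ k p δ c` — KS's `ℑ_k` of the layer
  (in the tree's rendering), `(ε₀, k)`-admissibility being `c.layerNorm k p δ ≤ ε₀²` up to the
  documented change of currency (the tree's norm is degree-one homogeneous in the deviation).
* `CauchyDevelopment.coneDist 𝒟 M a ℓ k p δ S = ⨅ {c.layerNorm k p δ | τ, c : KerrLayerChart 𝒟 M a τ ℓ,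
  range c ⊆ S}` — the requested **`𝓘⁺`-transversal smallness functional** of a region
  `S ⊆ 𝒟.carrier` (e.g. `S = J⁺(Σ')` for a late Cauchy hypersurface `Σ'`, or `S = univ`): the
  infimum of the layer norms of all admissible Kerr-adapted layers of `Kerr(M, a)` of scale `ℓ`
  lying inside `S`. `coneDist … S < ε ↔` some admissible layer inside `S` has norm `< ε`
  (`coneDist_lt_iff`), so the requester's "`∀ ε > 0 ∃ leaf L ⊂ J⁺(Σ)` with `coneDist(L; M, a) < ε`"
  is `∀ ε > 0, 𝒟.coneDist M a ℓ k p δ (J⁺(Σ)) < ε`, i.e. `𝒟.coneDist M a ℓ k p δ (J⁺(Σ)) = 0`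
  (`coneDist_eq_zero_iff`); it is ANTITONE in `S` (`coneDist_anti`: fewer layers in a smaller
  region) and monotone in `k` (`coneDist_mono`). As the request says, no monotonicity along the
  evolution is claimed or built in.

## Junk values and scope (documented, not hidden)

* `0 < ℓ` is intended. For `ℓ ≤ 0` the layer is EMPTY (`KerrAdapted.layer_eq_bot_of_nonpos`), the
  empty map is an admissible layer chart of norm `0`, and `coneDist … = 0` for every `S`
  (`coneDist_of_nonpos`, the anti-vacuity flag): consumers quantify `0 < ℓ` (and fix `ℓ` from the
  configuration — the norm is not scale-free, `KerrAdaptedLayerNorm.lean`, "Junk values").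
* `Kerr.IsSubextremal M a` / `0 < M` are NOT required by the structure (the consumers quantify the
  target `(M, a)`); for `M ≤ 0` the excised core `{r ≤ M}` may be empty and the derivative weights
  of the norm degenerate as documented in `RecedingKerrInitialLayerNorm.lean`.
* `coneDist … S = ⊤` when no admissible layer of scale `ℓ` fits inside `S` with finite norm (in
  particular when none fits at all, e.g. `S = ∅` with `0 < ℓ`): "never enters" reads `= ⊤` or
  `≥ ε₁`, never a junk `0`.
* Exponents `(k, p, δ)` are parameters as in the norm files (recommended `1 < p < 2`, `0 < δ < 1`;
  the `SettledCapture` lines use `(1/2, 1/2)`).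
* Not here: the double-null seed data of D1, any field equation, any assertion that a given
  development possesses admissible layers (that is the content of the route items: Remark 4.3 of
  the source for Cauchy data, and the late-time statements of the decomposition cell).

## References

* S. Klainerman, J. Szeftel, *Kerr stability for small angular momentum*, Pure Appl. Math. Q. 19
  (2023) 791–1678, arXiv:2104.11857: §3.1 (initial data layer, arXiv p. 43), §3.6 (initial layer
  norm), Def. 4.2–4.4 and Remark 4.3 (admissible layers, arXiv p. 51), Main Theorem (p. 52).
* M. Dafermos, G. Holzegel, I. Rodnianski, M. Taylor, *The non-linear stability of the
  Schwarzschild family of black holes*, arXiv:2104.08222, Ch. 8 §1.4 (energies on cones; variant D1).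
* M. Dafermos, I. Rodnianski, arXiv:0910.4957, §3–§4 (the `r^p` hierarchy; leaves reaching `𝓘⁺`).
* H. Ringström, *The Cauchy Problem in General Relativity*, EMS 2009, Def. 16.2 (developments).
-/

noncomputable section

open Set TopologicalSpace
open scoped Manifold ContDiff Topology ENNReal

universe u

namespace Literature.Geometry.Lorentzian

/-! ### One Kerr hole at rest at the origin: layer, background, norm -/

namespace KerrAdapted

/-- The **Kerr-adapted initial layer of ONE hole `Kerr(M, a)` at rest at the origin** of its
Kerr–Schild chart, based at lab time `τ`, of scale `ℓ`: `KerrAdapted.layer` with `N = 1`, `Λ = 1`,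
`ξ = 0` — the region `{0 < s < ℓ} ∩ {M < r}` of `E4` between two leaves asymptotic to the outgoing
null cones (tortoise term included), near part `{|x̲| ≤ ℓ}`, far part `{|x̲| ≥ ℓ}` unbounded in
the outgoing direction. Template: the initial data layer `𝓛₀(a₀, m₀) = 𝓛_ext ∪ 𝓛_int` of
Klainerman–Szeftel, arXiv:2104.11857, §3.1. [cite: KlainermanSzeftel2023, §3.1 (initial data layer, arXiv p. 43)] -/
abbrev restLayer (M a τ ℓ : ℝ) : Opens E4 :=
  layer (fun _ : Fin 1 ↦ M) (fun _ ↦ a) (fun _ ↦ (1 : lorentzGroup)) (fun _ ↦ (0 : E3)) τ ℓ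

/-- The reference background of the one-hole layer: domain `restLayer M a τ ℓ`, reference form the
Kerr–Schild form of `Kerr(M, a)` at rest (`KerrAdapted.background` with `N = 1`, `Λ = 1`, `ξ = 0`),
time function the adapted layer time, radius `|x̲|`. Klainerman–Szeftel, arXiv:2104.11857, §3.1.
[cite: KlainermanSzeftel2023, §3.1] -/
abbrev restBackground (M a τ ℓ : ℝ) : ModelBackground :=
  background (fun _ : Fin 1 ↦ M) (fun _ ↦ a) (fun _ ↦ (1 : lorentzGroup)) (fun _ ↦ (0 : E3)) τ ℓ

/-- The domain of the one-hole background is the one-hole layer. [cite: KlainermanSzeftel2023, §3.1] -/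
theorem restBackground_domain (M a τ ℓ : ℝ) :
    (restBackground M a τ ℓ).domain = restLayer M a τ ℓ :=
  rfl

/-- Anti-vacuity flag: for `ℓ ≤ 0` the one-hole layer is empty (as a type).
Klainerman–Szeftel, arXiv:2104.11857, §3.1. [cite: KlainermanSzeftel2023, §3.1] -/
theorem isEmpty_restLayer_of_nonpos (M a τ : ℝ) {ℓ : ℝ} (hℓ : ℓ ≤ 0) :
    IsEmpty (restLayer M a τ ℓ) := by
  refine ⟨fun ⟨z, hz⟩ ↦ ?_⟩
  have hbot : (restLayer M a τ ℓ : Opens E4) = ⊥ :=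
    layer_eq_bot_of_nonpos (fun _ : Fin 1 ↦ M) (fun _ ↦ a) (fun _ ↦ (1 : lorentzGroup)) (fun _ ↦ (0 : E3)) τ ℓ hℓ
  rw [hbot] at hz
  simp at hz

end KerrAdapted

namespace Spacetime

/-- The **one-hole Kerr-adapted layer norm** of a chart `Φ : restLayer M a τ ℓ → 𝓢.carrier` of the
spacetime `𝓢` with exponents `(k, p, δ)`: `Spacetime.kerrAdaptedLayerNorm` with `N = 1`, `Λ = 1`,
`ξ = 0` — near `Cᵏ` sup of the deviation `Φ^* g − g_{M,a}` plus the square roots of the far `r^p`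
and transversal fluxes (the tree's rendering of the initial layer norm `ℑ_k` of
Klainerman–Szeftel, arXiv:2104.11857, §3.6; comparison in `KerrAdaptedLayerNorm.lean`).
[cite: KlainermanSzeftel2023, §3.6 (initial data layer norm)] -/
def kerrLayerNorm (𝓢 : Spacetime.{u} 4) (M a τ ℓ : ℝ) (k : ℕ) (p δ : ℝ)
    (Φ : KerrAdapted.restLayer M a τ ℓ → 𝓢.carrier) : ℝ≥0∞ :=
  𝓢.kerrAdaptedLayerNorm (fun _ : Fin 1 ↦ M) (fun _ ↦ a) (fun _ ↦ (1 : lorentzGroup))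
    (fun _ ↦ (0 : E3)) τ ℓ k p δ Φ

/-- Unfolding lemma: the one-hole norm is the `N = 1`, `Λ = 1`, `ξ = 0` Kerr-adapted layer norm.
[cite: KlainermanSzeftel2023, §3.6] -/
theorem kerrLayerNorm_eq (𝓢 : Spacetime.{u} 4) (M a τ ℓ : ℝ) (k : ℕ) (p δ : ℝ)
    (Φ : KerrAdapted.restLayer M a τ ℓ → 𝓢.carrier) :
    𝓢.kerrLayerNorm M a τ ℓ k p δ Φ = 𝓢.kerrAdaptedLayerNorm (fun _ : Fin 1 ↦ M) (fun _ ↦ a)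
      (fun _ ↦ (1 : lorentzGroup)) (fun _ ↦ (0 : E3)) τ ℓ k p δ Φ :=
  rfl

/-- The one-hole norm is monotone in the number of derivatives. [cite: KlainermanSzeftel2023, §3.6] -/
theorem kerrLayerNorm_mono (𝓢 : Spacetime.{u} 4) (M a τ ℓ : ℝ) {k k' : ℕ} (h : k ≤ k') (p δ : ℝ)
    (Φ : KerrAdapted.restLayer M a τ ℓ → 𝓢.carrier) :
    𝓢.kerrLayerNorm M a τ ℓ k p δ Φ ≤ 𝓢.kerrLayerNorm M a τ ℓ k' p δ Φ := by
  rw [kerrLayerNorm_eq, kerrLayerNorm_eq]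
  exact 𝓢.kerrAdaptedLayerNorm_mono _ _ _ _ _ _ h p δ Φ

/-- The norm of a chart of the EMPTY layer (`ℓ ≤ 0`) is `0`: the deviation extended by zero
vanishes identically. (Anti-vacuity flag; consumers quantify `0 < ℓ`.) [cite: KlainermanSzeftel2023, §3.6] -/
theorem kerrLayerNorm_of_nonpos (𝓢 : Spacetime.{u} 4) (M a τ : ℝ) {ℓ : ℝ} (hℓ : ℓ ≤ 0) (k : ℕ)
    (p δ : ℝ) (Φ : KerrAdapted.restLayer M a τ ℓ → 𝓢.carrier) :
    𝓢.kerrLayerNorm M a τ ℓ k p δ Φ = 0 := by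
  have hdev : 𝓢.deviationExtend (KerrAdapted.restBackground M a τ ℓ) Φ = 0 := by
    funext y
    refine 𝓢.deviationExtend_of_not_mem (KerrAdapted.restBackground M a τ ℓ) Φ fun hy ↦ ?_
    exact (KerrAdapted.isEmpty_restLayer_of_nonpos M a τ hℓ).false ⟨y, hy⟩
  rw [kerrLayerNorm_eq, Spacetime.kerrAdaptedLayerNorm, hdev, KerrAdapted.nearCkNorm_zero,
    KerrAdapted.rpFlux_zero, KerrAdapted.transversalFlux_zero,
    ENNReal.zero_rpow_of_pos (by norm_num : (0 : ℝ) < 1 / 2)]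
  simp

end Spacetime

/-! ### Admissible Kerr-adapted layers inside a Cauchy development -/

namespace CauchyDevelopment

variable {X : Type u} [TopologicalSpace X] [ChartedSpace E3 X] [IsManifold (𝓡 3) ∞ X]
  [ConnectedSpace X] {D : InitialDataSet (𝓡 3) X}

/-- **An admissible Kerr-adapted initial data layer of `Kerr(M, a)` inside the Cauchy development
`𝒟`**, of scale `ℓ`, based at lab time `τ` (variant D1′ of request `defn-ConeSeedData`): a chart
`Φ : KerrAdapted.restLayer M a τ ℓ → 𝒟.carrier` from the one-hole Kerr-adapted layer which is
(1) smooth, (2) an open embedding (its image is an open spacetime region of `𝒟` charted by the layer,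
the initial data layer `𝓛₀(a, M)` of Klainerman–Szeftel §3.1), (3) ADMISSIBLE: its image lies in the
causal future `J⁺(ι(X))` of the Cauchy hypersurface of `𝒟` (Def. 4.2: "lies in the future of an
asymptotically flat initial data set, supported on a spacelike hypersurface"), and (4) time-oriented:
`dΦ` maps the Kerr–Schild time vector field to future-directed vectors. Every quantity of the layer
(deviation, norm) is read off `𝒟.metric` through `Φ`; no seed data are posited. The four clauses are
those of the layer charts of the summit's `SettledCapture` lines. [cite: KlainermanSzeftel2023, §3.1 (arXiv p. 43) and Def. 4.2 (arXiv p. 51)] -/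
structure KerrLayerChart (𝒟 : CauchyDevelopment D) (M a τ ℓ : ℝ) where
  /-- The chart map from the one-hole Kerr-adapted layer into the development. -/
  toFun : KerrAdapted.restLayer M a τ ℓ → 𝒟.carrier
  /-- (1) The chart is smooth. -/
  contMDiff : ContMDiff 𝓘(ℝ, E4) (𝓡 4) ∞ toFun
  /-- (2) The chart is an open embedding. -/
  isOpenEmbedding : Topology.IsOpenEmbedding toFun
  /-- (3) Admissibility: the layer lies in the causal future of the Cauchy hypersurface `ι(X)`. -/
  range_subset_causalFuture :
    range toFun ⊆ 𝒟.metric.causalFuture 𝒟.timeOrientation (range 𝒟.embed)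
  /-- (4) Time orientation: `dΦ (Kerr.timeVector M a)` is future-directed. -/
  isFutureDirected : ∀ x : KerrAdapted.restLayer M a τ ℓ,
    𝒟.timeOrientation.IsFutureDirected (mfderiv 𝓘(ℝ, E4) (𝓡 4) toFun x (Kerr.timeVector M a x.1))

namespace KerrLayerChart

variable {𝒟 : CauchyDevelopment D} {M a τ ℓ : ℝ}

/-- **The initial layer norm of an admissible layer** (KS's `ℑ_k` in the tree's rendering): the
one-hole Kerr-adapted layer norm of its chart with exponents `(k, p, δ)`.
[cite: KlainermanSzeftel2023, §3.6 and Def. 4.2] -/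
def layerNorm (c : 𝒟.KerrLayerChart M a τ ℓ) (k : ℕ) (p δ : ℝ) : ℝ≥0∞ :=
  𝒟.toSpacetime.kerrLayerNorm M a τ ℓ k p δ c.toFun

/-- Unfolding lemma. [cite: KlainermanSzeftel2023, §3.6] -/
theorem layerNorm_eq (c : 𝒟.KerrLayerChart M a τ ℓ) (k : ℕ) (p δ : ℝ) :
    c.layerNorm k p δ = 𝒟.toSpacetime.kerrLayerNorm M a τ ℓ k p δ c.toFun :=
  rfl

/-- The layer norm is monotone in the number of derivatives `k`. [cite: KlainermanSzeftel2023, §3.6] -/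
theorem layerNorm_mono (c : 𝒟.KerrLayerChart M a τ ℓ) {k k' : ℕ} (h : k ≤ k') (p δ : ℝ) :
    c.layerNorm k p δ ≤ c.layerNorm k' p δ :=
  𝒟.toSpacetime.kerrLayerNorm_mono M a τ ℓ h p δ c.toFun

/-- The image of an admissible layer is open in the development. [cite: KlainermanSzeftel2023, §3.1] -/
theorem isOpen_range (c : 𝒟.KerrLayerChart M a τ ℓ) : IsOpen (range c.toFun) :=
  c.isOpenEmbedding.isOpen_range

/-- **The empty layer** (`ℓ ≤ 0`): the empty map is, vacuously, an admissible layer chart — the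
anti-vacuity flag of the structure; consumers quantify `0 < ℓ`. [cite: KlainermanSzeftel2023, §3.1] -/
def ofNonpos (𝒟 : CauchyDevelopment D) (M a τ : ℝ) {ℓ : ℝ} (hℓ : ℓ ≤ 0) :
    𝒟.KerrLayerChart M a τ ℓ :=
  haveI := KerrAdapted.isEmpty_restLayer_of_nonpos M a τ hℓ
  { toFun := fun x ↦ isEmptyElim x
    contMDiff := fun x ↦ isEmptyElim x
    isOpenEmbedding := Topology.IsOpenEmbedding.of_isEmpty _
    range_subset_causalFuture := by simp [Set.range_eq_empty]
    isFutureDirected := fun x ↦ isEmptyElim x }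

/-- The empty layer has norm `0`. [cite: KlainermanSzeftel2023, §3.6] -/
theorem layerNorm_of_nonpos (hℓ : ℓ ≤ 0) (c : 𝒟.KerrLayerChart M a τ ℓ) (k : ℕ) (p δ : ℝ) :
    c.layerNorm k p δ = 0 :=
  𝒟.toSpacetime.kerrLayerNorm_of_nonpos M a τ hℓ k p δ c.toFun

end KerrLayerChart

/-! ### The cone distance -/

/-- **The `𝓘⁺`-transversal cone distance of the region `S ⊆ 𝒟.carrier` to `Kerr(M, a)`** at scale
`ℓ` with exponents `(k, p, δ)` (variant D1′ of request `defn-ConeSeedData`, the requester's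
`coneDist`): the infimum, over all base times `τ` and all ADMISSIBLE Kerr-adapted initial data
layers `c` of `Kerr(M, a)` of scale `ℓ` inside `𝒟` whose image lies in `S`, of their initial layer
norms `c.layerNorm k p δ`. So `coneDist … S < ε` iff `S` contains an admissible layer of norm `< ε`
(`coneDist_lt_iff`) — the hypothesis "`(ε₀, k)`-admissible initial data layer in the future of the
data" of Klainerman–Szeftel's Main Theorem, located inside `S` — and `coneDist … S = ⊤` if no
admissible layer of finite norm fits inside `S`. Antitone in `S`, monotone in `k`; equal to the junk
value `0` when `ℓ ≤ 0` (`coneDist_of_nonpos`). No monotonicity along the evolution is claimed.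
[cite: KlainermanSzeftel2023, Def. 4.2 and Main Theorem (arXiv pp. 51–52)] -/
def coneDist (𝒟 : CauchyDevelopment D) (M a ℓ : ℝ) (k : ℕ) (p δ : ℝ) (S : Set 𝒟.carrier) : ℝ≥0∞ :=
  ⨅ (τ : ℝ) (c : 𝒟.KerrLayerChart M a τ ℓ) (_ : range c.toFun ⊆ S), c.layerNorm k p δ

variable (𝒟 : CauchyDevelopment D) (M a ℓ : ℝ) (k : ℕ) (p δ : ℝ)

/-- Unfolding lemma. [cite: KlainermanSzeftel2023, Def. 4.2] -/
theorem coneDist_eq (S : Set 𝒟.carrier) :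
    𝒟.coneDist M a ℓ k p δ S =
      ⨅ (τ : ℝ) (c : 𝒟.KerrLayerChart M a τ ℓ) (_ : range c.toFun ⊆ S), c.layerNorm k p δ :=
  rfl

/-- Every admissible layer inside `S` bounds the cone distance of `S` from above.
[cite: KlainermanSzeftel2023, Def. 4.2] -/
theorem coneDist_le_layerNorm {S : Set 𝒟.carrier} {τ : ℝ} (c : 𝒟.KerrLayerChart M a τ ℓ)
    (hc : range c.toFun ⊆ S) : 𝒟.coneDist M a ℓ k p δ S ≤ c.layerNorm k p δ :=
  iInf_le_of_le τ (iInf_le_of_le c (iInf_le_of_le hc le_rfl))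

/-- Lower bounds: `b ≤ coneDist … S` iff every admissible layer inside `S` has norm `≥ b`.
[cite: KlainermanSzeftel2023, Def. 4.2] -/
theorem le_coneDist_iff {S : Set 𝒟.carrier} {b : ℝ≥0∞} :
    b ≤ 𝒟.coneDist M a ℓ k p δ S ↔
      ∀ (τ : ℝ) (c : 𝒟.KerrLayerChart M a τ ℓ), range c.toFun ⊆ S → b ≤ c.layerNorm k p δ := by
  simp only [coneDist, le_iInf_iff]

/-- **Basin entry read on the cone distance**: `coneDist … S < ε` iff `S` contains an admissible
Kerr-adapted layer of `Kerr(M, a)` of scale `ℓ` with initial layer norm `< ε`.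
[cite: KlainermanSzeftel2023, Def. 4.2 and Main Theorem] -/
theorem coneDist_lt_iff {S : Set 𝒟.carrier} {b : ℝ≥0∞} :
    𝒟.coneDist M a ℓ k p δ S < b ↔
      ∃ (τ : ℝ) (c : 𝒟.KerrLayerChart M a τ ℓ), range c.toFun ⊆ S ∧ c.layerNorm k p δ < b := by
  simp only [coneDist, iInf_lt_iff, exists_prop]

/-- `coneDist … S = 0` iff `S` contains admissible layers of arbitrarily small norm (the requester's
"`∀ ε > 0 ∃` leaf `L ⊂ S` with `coneDist(L) < ε`"). [cite: KlainermanSzeftel2023, Def. 4.2] -/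
theorem coneDist_eq_zero_iff {S : Set 𝒟.carrier} :
    𝒟.coneDist M a ℓ k p δ S = 0 ↔
      ∀ b : ℝ≥0∞, 0 < b →
        ∃ (τ : ℝ) (c : 𝒟.KerrLayerChart M a τ ℓ), range c.toFun ⊆ S ∧ c.layerNorm k p δ < b := by
  constructor
  · intro h0 b hb
    exact (𝒟.coneDist_lt_iff M a ℓ k p δ).1 (h0.trans_lt hb)
  · intro h
    by_contra hne
    obtain ⟨τ, c, hc, hlt⟩ := h _ (pos_iff_ne_zero.2 hne)
    exact absurd hlt (not_lt.2 (𝒟.coneDist_le_layerNorm M a ℓ k p δ c hc))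

/-- The cone distance is ANTITONE in the region: a smaller region contains fewer admissible
layers. [cite: KlainermanSzeftel2023, Def. 4.2] -/
theorem coneDist_anti {S T : Set 𝒟.carrier} (h : S ⊆ T) :
    𝒟.coneDist M a ℓ k p δ T ≤ 𝒟.coneDist M a ℓ k p δ S :=
  (𝒟.le_coneDist_iff M a ℓ k p δ).2 fun _ c hc ↦
    𝒟.coneDist_le_layerNorm M a ℓ k p δ c (hc.trans h)

/-- The cone distance is monotone in the number of derivatives `k`. [cite: KlainermanSzeftel2023, §3.6] -/
theorem coneDist_mono {k k' : ℕ} (h : k ≤ k') (S : Set 𝒟.carrier) :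
    𝒟.coneDist M a ℓ k p δ S ≤ 𝒟.coneDist M a ℓ k' p δ S :=
  (𝒟.le_coneDist_iff M a ℓ k' p δ).2 fun _ c hc ↦
    (𝒟.coneDist_le_layerNorm M a ℓ k p δ c hc).trans (c.layerNorm_mono h p δ)

/-- Anti-vacuity flag: for `ℓ ≤ 0` (empty layer) the cone distance is the junk value `0` for every
region — consumers quantify `0 < ℓ`. [cite: KlainermanSzeftel2023, §3.1] -/
theorem coneDist_of_nonpos {ℓ : ℝ} (hℓ : ℓ ≤ 0) (S : Set 𝒟.carrier) :
    𝒟.coneDist M a ℓ k p δ S = 0 := by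
  refine le_antisymm ?_ bot_le
  refine (𝒟.coneDist_le_layerNorm M a ℓ k p δ (KerrLayerChart.ofNonpos 𝒟 M a 0 hℓ) ?_).trans
    (le_of_eq (KerrLayerChart.layerNorm_of_nonpos hℓ _ k p δ))
  haveI := KerrAdapted.isEmpty_restLayer_of_nonpos M a (0 : ℝ) hℓ
  simp [Set.range_eq_empty]

/-- If no admissible layer of scale `ℓ` fits inside `S` (for instance `S = ∅` with a non-empty
layer), the cone distance of `S` is `⊤` ("never enters" is `⊤`, not a junk `0`).
[cite: KlainermanSzeftel2023, Def. 4.2] -/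
theorem coneDist_eq_top_of_forall {S : Set 𝒟.carrier}
    (h : ∀ (τ : ℝ) (c : 𝒟.KerrLayerChart M a τ ℓ), ¬ range c.toFun ⊆ S) :
    𝒟.coneDist M a ℓ k p δ S = ⊤ := by
  simp only [coneDist, iInf_eq_top]
  exact fun τ c hc ↦ (h τ c hc).elim

end CauchyDevelopment

end Literature.Geometry.Lorentzian

end
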